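import Summits.AtomisticToContinuum.BoseEinsteinCondensation.Theorems.BoxCountShadowDisplacementSibRing
import HarnessLib

/-!
# BoxCountShadowDisplacementSib — LOC_h at two scales decides the residual: UGS ∧ LOC_h(η) ∧ CSUF_h(η) ∧ SUF_h(η) ⟹ BEC

THE RESULT (lens-6 g36, DISP dossier, 0 sorry).  The horizon condensation piece LOC_h(η)
(`GroundStateHorizonCondensation η`, which quantifies over EVERY horizon constant `M > 0`) read at the PARENT
window `2M`, together with the truncated density law DLT_h(η) (PROVED, `CoercivityLine.densityLLNTrunc_holds`)
and Bose symmetry, gives one-cell count affinity at every EVEN block number of the window `M`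
(`horizonCellCountAffinityEven_of_loc`): two-scale condensation forces sibling coherence
(`BoxCountShadowSiblingCoherence`), sibling coherence forces the sibling displacement inequality
`Q_{B→σB}(j) ≤ 16 P_B(j)` off a set of small pair MASS, the sibling ring share (`ringShareDefectSib_le_trunc`,
from DLT_h) converts pair mass into pair WEIGHT and supplies `Q_{B→σB}(j) ≥ θ·K⁻³P̄_B(j)`, whence insertion
tolerance `P_B(j) ≥ (θ/16)·K⁻³P̄_B(j)` on a pair set of weight `≥ 1/2` and `cellCountAffinity ≥ 2⁻¹(θ/16)^{1/2}`
(`cellCountAffinity_ge_of_insertion`).  The parity restriction is lifted at the LAB level by refinement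
monotonicity (`labelAffinity_mul_le`: `LAB(2K) ≤ LAB(K)`, and `2K` is even and lies in the window of constant
`M/2`): MARG^e ∧ CSUF_h ⟹ NUM^e, NUM^e ∧ SUF_h ⟹ LAB^e, LAB^e ⟹ LAB_h (`horizonLabelAffinity_of_even`).  Hence
`horizonLabelAffinity_of_loc : LOC_h η → CSUF_h η → SUF_h η → LAB_h η` and the deciding kernel
`bec_of_loc : UGS → LOC_h η → CSUF_h η → SUF_h η → BoseEinsteinCondensation` — the residuals MARG_h / DISP_h /
INS_h of record are ABSORBED into LOC_h(η) (`horizonCellCountAffinity_of_loc`).  Consistency with the recorded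
witnesses: the number-locked (Mott) and parity-locked model states, on which MARG_h fails, violate LOC_h at the
parent window (a particle confined to one child cell of its parent has parent flat-mode occupation `1/8`);
NumberFilterBlindness (energy cannot see many-cell number filters at `η ≥ 1/4`) is not contradicted — the lever
is not the energy but LOC_h at a second scale, an input of record.  No instances, no notation, no sorry.
-/

-- (hand-2 g14 landing note: part 2 of 2 — §1–§3 of the original file 10 are in `BoxCountShadowDisplacementSibRing`, imported
-- above; §4–§5 below are byte-identical to lens-6's text.)


noncomputable section

open MeasureTheory Filter Set
open scoped ENNReal NNReal BigOperators Topology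

namespace Summit.AtomisticToContinuum.BoseEinsteinCondensation.Theorems.BoxCountShadow

open Literature.MathematicalPhysics.QuantumManyBody.BoseGas
open Summit.AtomisticToContinuum.BoseEinsteinCondensation.Theorems.BoxLatticeFSum
open Summit.AtomisticToContinuum.BoseEinsteinCondensation.Theorems.BoxLabelAffinity
open Summit.AtomisticToContinuum.BoseEinsteinCondensation.Theorems.BoxHorizonAffinity

variable {n : ℕ}
/-! ### §4  LOC_h ∧ DLT_h ⟹ MARG^e_h : two-scale condensation decides one-cell count affinity -/

/-- **LOC_h(η) ∧ DLT_h(η) ⟹ MARG^e_h(η)** (`M₀ = 1`, `c = 2⁻¹·(1/1024)^{1/2}`; LOC_h used at the parent window `2M`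
with target `1/4096`, DLT_h at the window `M` with target `1/512`, sibling ring-share threshold `θ = 1/64`,
displacement constant `1/16`). [folklore] -/
theorem horizonCellCountAffinityEven_of_loc (η : ℝ≥0) (hloc : GroundStateHorizonCondensation η)
    (hdlt : GroundStateHorizonDensityLLNTrunc η) : GroundStateHorizonCellCountAffinityEven η := by
  intro v hv ha
  refine ⟨1, one_pos, fun M hM => ?_⟩
  have hMpos : 0 < M := lt_of_lt_of_le one_pos hM
  obtain ⟨ρ₁, hρ₁, h1⟩ := hdlt v hv ha (1 / 512) (by norm_num) M hMpos
  obtain ⟨ρ₂, hρ₂, h2⟩ := hloc v hv ha (1 / 4096) (by norm_num) (2 * M) (by positivity)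
  refine ⟨(1 / 1024 : ℝ) ^ (1 / 2 : ℝ) * (1 / 2), mul_pos (Real.rpow_pos_of_pos (by norm_num) _) one_half_pos,
    min ρ₁ ρ₂, lt_min hρ₁ hρ₂, fun ρ hρ hρlt => ?_⟩
  have hρ1 : ρ < ρ₁ := hρlt.trans_le (min_le_left _ _)
  have hρ2 : ρ < ρ₂ := hρlt.trans_le (min_le_right _ _)
  have hA : 0 < M * ρ ^ (-(η : ℝ)) := mul_pos hMpos (Real.rpow_pos_of_pos hρ _)
  have hev : ∀ᶠ n : ℕ in atTop, 3 * (2 * (M * ρ ^ (-(η : ℝ))) / Real.sqrt ρ) ≤ sideLength ρ (n + 1) :=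
    (tendsto_add_atTop_nat 1).eventually ((tendsto_sideLength_atTop hρ).eventually_ge_atTop _)
  filter_upwards [h1 ρ hρ hρ1, h2 ρ hρ hρ2, hev] with n hn1 hn2 hLn hex K hK hKe hKw
  obtain ⟨K', hKK'⟩ := hKe
  obtain rfl : K = 2 * K' := by omega
  have hK' : 0 < K' := by omega
  have hKe' : Even (2 * K') := even_two_mul K'
  set L := sideLength ρ (n + 1) with hLdef
  have hL : 0 < L := sideLength_pos_of_inWindow hA hρ hK hKw
  have hK3 : 3 ≤ 2 * K' := three_le_of_inWindow hA hρ hK hKw hLn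
  set Φ := groundState v (n + 1) L with hΦdef
  have hΦm : Measurable Φ := measurable_groundState v (n + 1) L
  have hsym : ∀ (σ : Equiv.Perm (Fin (n + 1))) (X : Config (n + 1)), Φ (X ∘ σ) = Φ X :=
    fun σ X => groundState_comp_perm v L σ X
  have hΦ1 : ∫⁻ Y : Config n, ∫⁻ x, ENNReal.ofReal (Φ (Matrix.vecCons x Y)) ^ 2 = 1 := by
    rw [← lintegral_eq_lintegral_lintegral_vecCons (hΦm.ennreal_ofReal.pow_const 2)]
    exact lintegral_groundState_sq hex
  have hfin : (∫⁻ Y, sliceSq Φ Y) ≠ ⊤ := by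
    have h1' : ∫⁻ Y, sliceSq Φ Y = 1 := hΦ1
    rw [h1']; exact ENNReal.one_ne_top
  -- the two inputs at the two scales
  have hKw' : InWindow (2 * M * ρ ^ (-(η : ℝ))) ρ L K' := by
    have h := inWindow_coarse hK' hKw
    rwa [← mul_assoc] at h
  have hdep : blockDepletion L K' Φ ≤ ENNReal.ofReal (1 / 4096) := hn2 hex K' hK' hKw'
  have hCV : countVarianceTrunc L (2 * K') Φ ≤ ENNReal.ofReal (1 / 512) := hn1 hex (2 * K') hK hKw
  -- the two exceptional pair sets
  set D : Set (SubIdx (2 * K') × ℕ) := sibBad L (2 * K') Φ with hDdef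
  set E : Set (SubIdx (2 * K') × ℕ) := {p | cellPairMass L (2 * K') Φ p.1 (sib p.1) p.2 <
    ENNReal.ofReal (1 / 64) * pairWeight L (2 * K') Φ p} with hEdef
  have hE : pairWeightOn L (2 * K') Φ E ≤ 2 * ENNReal.ofReal (1 / 64) + 8 * countVarianceTrunc L (2 * K') Φ +
      blockWeight (2 * K') ^ 2 := ringShareDefectSib_le_trunc hL hK hKe' hΦm hsym hΦ1 (ENNReal.ofReal (1 / 64))
  have hD : ∑ C : SubIdx (2 * K'), ∑' j, D.indicator
      (fun p => cellPairMass L (2 * K') Φ p.1 (sib p.1) p.2) (C, j) ≤ 8 * blockDepletion L K' Φ :=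
    siblingBad_pairMass_le hL hK' hΦm hfin
  have h64 : ENNReal.ofReal 64 * ENNReal.ofReal (1 / 64) = 1 := by
    rw [← ENNReal.ofReal_mul (by norm_num)]; norm_num
  -- pair MASS → pair WEIGHT on the ring-share-good part of `D`
  have hDE : pairWeightOn L (2 * K') Φ (D ∩ Eᶜ) ≤ ENNReal.ofReal 64 * (8 * blockDepletion L K' Φ) := by
    have hpt : ∀ (B : SubIdx (2 * K')) (j : ℕ), (D ∩ Eᶜ).indicator (pairWeight L (2 * K') Φ) (B, j) ≤
        ENNReal.ofReal 64 * D.indicator (fun p => cellPairMass L (2 * K') Φ p.1 (sib p.1) p.2) (B, j) := by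
      intro B j
      by_cases hp : (B, j) ∈ D ∩ Eᶜ
      · rw [Set.indicator_of_mem hp, Set.indicator_of_mem hp.1]
        have hnE : ¬ (cellPairMass L (2 * K') Φ B (sib B) j <
            ENNReal.ofReal (1 / 64) * pairWeight L (2 * K') Φ (B, j)) := hp.2
        calc pairWeight L (2 * K') Φ (B, j)
            = ENNReal.ofReal 64 * (ENNReal.ofReal (1 / 64) * pairWeight L (2 * K') Φ (B, j)) := by
              rw [← mul_assoc, h64, one_mul]
          _ ≤ ENNReal.ofReal 64 * cellPairMass L (2 * K') Φ B (sib B) j := mul_le_mul' le_rfl (not_lt.1 hnE)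
      · rw [Set.indicator_of_notMem hp]; exact bot_le
    calc pairWeightOn L (2 * K') Φ (D ∩ Eᶜ)
        = ∑ B, ∑' j, (D ∩ Eᶜ).indicator (pairWeight L (2 * K') Φ) (B, j) := rfl
      _ ≤ ∑ B, ∑' j, ENNReal.ofReal 64 *
            D.indicator (fun p => cellPairMass L (2 * K') Φ p.1 (sib p.1) p.2) (B, j) :=
          Finset.sum_le_sum fun B _ => ENNReal.tsum_le_tsum fun j => hpt B j
      _ = ENNReal.ofReal 64 *
            ∑ B, ∑' j, D.indicator (fun p => cellPairMass L (2 * K') Φ p.1 (sib p.1) p.2) (B, j) := by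
          rw [Finset.mul_sum]
          refine Finset.sum_congr rfl fun B _ => ?_
          rw [ENNReal.tsum_mul_left]
      _ ≤ ENNReal.ofReal 64 * (8 * blockDepletion L K' Φ) := mul_le_mul' le_rfl hD
  -- numerics
  have eA : ENNReal.ofReal 64 * (8 * ENNReal.ofReal (1 / 4096)) = ENNReal.ofReal (1 / 8) := by
    rw [show (1 / 4096 : ℝ) = (1 / 8) * (1 / 512) by norm_num, ENNReal.ofReal_mul (by norm_num : (0:ℝ) ≤ 1 / 8)]
    rw [show (8 : ℝ≥0∞) * (ENNReal.ofReal (1 / 8) * ENNReal.ofReal (1 / 512)) =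
      (8 * ENNReal.ofReal (1 / 8)) * ENNReal.ofReal (1 / 512) by ring]
    have h8 : (8 : ℝ≥0∞) * ENNReal.ofReal (1 / 8) = 1 := by
      rw [ENNReal.ofReal_div_of_pos (by norm_num : (0:ℝ) < 8), ENNReal.ofReal_one, ENNReal.ofReal_ofNat,
        ENNReal.mul_div_cancel (by norm_num) ENNReal.ofNat_ne_top]
    rw [h8, one_mul, ← ENNReal.ofReal_mul (by norm_num)]
    norm_num
  have eθ : (2 : ℝ≥0∞) * ENNReal.ofReal (1 / 64) = ENNReal.ofReal (1 / 32) := by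
    rw [show (1 / 32 : ℝ) = 2 * (1 / 64) by norm_num, ENNReal.ofReal_mul (by norm_num : (0 : ℝ) ≤ 2),
      ENNReal.ofReal_ofNat]
  have e8 : (8 : ℝ≥0∞) * ENNReal.ofReal (1 / 512) = ENNReal.ofReal (1 / 64) := by
    rw [show (1 / 64 : ℝ) = 8 * (1 / 512) by norm_num, ENNReal.ofReal_mul (by norm_num : (0 : ℝ) ≤ 8),
      ENNReal.ofReal_ofNat]
  have e3 : blockWeight (2 * K') ^ 2 ≤ ENNReal.ofReal (1 / 27) := by
    rw [blockWeight_sq hK]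
    apply ENNReal.ofReal_le_ofReal
    have hK3r : (3 : ℝ) ≤ ((2 * K' : ℕ) : ℝ) := by exact_mod_cast hK3
    have h27 : (27 : ℝ) ≤ (((2 * K' : ℕ) : ℝ)) ^ 3 :=
      calc (27 : ℝ) = 3 ^ 3 := by norm_num
        _ ≤ (((2 * K' : ℕ) : ℝ)) ^ 3 := pow_le_pow_left₀ (by norm_num) hK3r 3
    rw [one_div]
    exact inv_anti₀ (by norm_num) h27
  have hhalf : ENNReal.ofReal (1 / 2) = 1 / 2 := by
    rw [ENNReal.ofReal_div_of_pos two_pos, ENNReal.ofReal_one, ENNReal.ofReal_ofNat]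
  -- the exceptional weight
  have hGc : pairWeightOn L (2 * K') Φ (D ∪ E) ≤ ENNReal.ofReal (1 / 4) :=
    calc pairWeightOn L (2 * K') Φ (D ∪ E)
        ≤ pairWeightOn L (2 * K') Φ (D ∩ Eᶜ) + pairWeightOn L (2 * K') Φ E := pairWeightOn_union_le L _ Φ D E
      _ ≤ ENNReal.ofReal 64 * (8 * ENNReal.ofReal (1 / 4096)) +
            (2 * ENNReal.ofReal (1 / 64) + 8 * ENNReal.ofReal (1 / 512) + blockWeight (2 * K') ^ 2) :=
          add_le_add (hDE.trans (mul_le_mul' le_rfl (mul_le_mul' le_rfl hdep)))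
            (hE.trans (add_le_add (add_le_add le_rfl (mul_le_mul' le_rfl hCV)) le_rfl))
      _ ≤ ENNReal.ofReal (1 / 8) + (ENNReal.ofReal (1 / 32) + ENNReal.ofReal (1 / 64) + ENNReal.ofReal (1 / 27)) :=
          add_le_add eA.le (add_le_add (add_le_add eθ.le e8.le) e3)
      _ = ENNReal.ofReal (1 / 8 + (1 / 32 + 1 / 64 + 1 / 27)) := by
          rw [← ENNReal.ofReal_add (by norm_num) (by norm_num), ← ENNReal.ofReal_add (by norm_num) (by norm_num),
            ← ENNReal.ofReal_add (by norm_num) (by norm_num)]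
      _ ≤ ENNReal.ofReal (1 / 4) := ENNReal.ofReal_le_ofReal (by norm_num)
  -- the good set and its weight
  set G : Set (SubIdx (2 * K') × ℕ) := (D ∪ E)ᶜ with hGdef
  have hGw : ENNReal.ofReal (1 / 2) ≤ pairWeightOn L (2 * K') Φ G := by
    have htot : pairWeightOn L (2 * K') Φ G + pairWeightOn L (2 * K') Φ Gᶜ = 1 := by
      rw [pairWeightOn_add_compl, pairWeightOn_univ hK hΦ1]
    have hc : pairWeightOn L (2 * K') Φ Gᶜ ≤ 1 / 2 := by
      rw [hGdef, compl_compl, ← hhalf]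
      exact hGc.trans (ENNReal.ofReal_le_ofReal (by norm_num))
    have hfin' : (1 / 2 : ℝ≥0∞) ≠ ⊤ := ENNReal.div_ne_top ENNReal.one_ne_top two_ne_zero
    have key : 1 / 2 + 1 / 2 ≤ pairWeightOn L (2 * K') Φ G + 1 / 2 :=
      calc (1 / 2 : ℝ≥0∞) + 1 / 2 = 1 := ENNReal.add_halves 1
        _ = pairWeightOn L (2 * K') Φ G + pairWeightOn L (2 * K') Φ Gᶜ := htot.symm
        _ ≤ pairWeightOn L (2 * K') Φ G + 1 / 2 := add_le_add le_rfl hc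
    rw [hhalf]
    exact (ENNReal.add_le_add_iff_right hfin').1 key
  -- insertion tolerance on the good set
  have e16 : ENNReal.ofReal (1 / 16) * 16 = 1 := by
    have h16 : (16 : ℝ≥0∞) = ENNReal.ofReal 16 := by norm_num
    rw [h16, ← ENNReal.ofReal_mul (by norm_num)]; norm_num
  have e1024 : ENNReal.ofReal (1 / 16) * ENNReal.ofReal (1 / 64) = ENNReal.ofReal (1 / 1024) := by
    rw [← ENNReal.ofReal_mul (by norm_num)]; norm_num
  have hI : ∀ (B : SubIdx (2 * K')) (j : ℕ), (B, j) ∈ G →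
      ENNReal.ofReal (1 / 1024) * pairWeight L (2 * K') Φ (B, j) ≤ cellMass L (2 * K') Φ B j := by
    intro B j hp
    have hnD : ¬ (16 * cellMass L (2 * K') Φ B j < cellPairMass L (2 * K') Φ B (sib B) j) :=
      fun h => hp (Or.inl h)
    have hnE : ¬ (cellPairMass L (2 * K') Φ B (sib B) j <
        ENNReal.ofReal (1 / 64) * pairWeight L (2 * K') Φ (B, j)) := fun h => hp (Or.inr h)
    calc ENNReal.ofReal (1 / 1024) * pairWeight L (2 * K') Φ (B, j)
        = ENNReal.ofReal (1 / 16) * (ENNReal.ofReal (1 / 64) * pairWeight L (2 * K') Φ (B, j)) := by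
          rw [← mul_assoc, e1024]
      _ ≤ ENNReal.ofReal (1 / 16) * cellPairMass L (2 * K') Φ B (sib B) j := mul_le_mul' le_rfl (not_lt.1 hnE)
      _ ≤ ENNReal.ofReal (1 / 16) * (16 * cellMass L (2 * K') Φ B j) := mul_le_mul' le_rfl (not_lt.1 hnD)
      _ = cellMass L (2 * K') Φ B j := by rw [← mul_assoc, e16, one_mul]
  -- conclude with the insertion functional inequality
  calc ENNReal.ofReal ((1 / 1024 : ℝ) ^ (1 / 2 : ℝ) * (1 / 2))
      = ENNReal.ofReal (1 / 1024) ^ (1 / 2 : ℝ) * ENNReal.ofReal (1 / 2) := by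
        rw [ENNReal.ofReal_mul (Real.rpow_nonneg (by norm_num) _),
          ENNReal.ofReal_rpow_of_nonneg (by norm_num) (by norm_num)]
    _ ≤ ENNReal.ofReal (1 / 1024) ^ (1 / 2 : ℝ) * pairWeightOn L (2 * K') Φ G := mul_le_mul' le_rfl hGw
    _ ≤ cellCountAffinity L (2 * K') Φ := cellCountAffinity_ge_of_insertion L (2 * K') Φ _ G hI

/-! ### §5  The even chain MARG^e ⟹ NUM^e ⟹ LAB^e ⟹ LAB_h and the deciding kernel -/

/-- **MARG^e_h ∧ CSUF_h ⟹ NUM^e_h** (the proof of `horizonCountAffinity_of_cell`, parity threaded). [folklore] -/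
theorem horizonCountAffinityEven_of_cell (η : ℝ≥0) (hmarg : GroundStateHorizonCellCountAffinityEven η)
    (hcsuf : GroundStateHorizonCellCountSufficiency η) : GroundStateHorizonCountAffinityEven η := by
  intro v hv ha
  obtain ⟨M₁, hM₁, hmarg'⟩ := hmarg v hv ha
  obtain ⟨M₂, hM₂, hcsuf'⟩ := hcsuf v hv ha
  refine ⟨max M₁ M₂, lt_max_of_lt_left hM₁, fun M hM => ?_⟩
  obtain ⟨c, hc, ρ₁, hρ₁, hc'⟩ := hmarg' M ((le_max_left _ _).trans hM)
  obtain ⟨s, hs, ρ₂, hρ₂, hs'⟩ := hcsuf' M ((le_max_right _ _).trans hM)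
  refine ⟨s * c, mul_pos hs hc, min ρ₁ ρ₂, lt_min hρ₁ hρ₂, fun ρ hρ hρlt => ?_⟩
  have h1 : ρ < ρ₁ := hρlt.trans_le (min_le_left _ _)
  have h2 : ρ < ρ₂ := hρlt.trans_le (min_le_right _ _)
  filter_upwards [hc' ρ hρ h1, hs' ρ hρ h2] with n hcn hsn hex K hK hKe hKw
  calc ENNReal.ofReal (s * c) = ENNReal.ofReal s * ENNReal.ofReal c := ENNReal.ofReal_mul hs.le
    _ ≤ ENNReal.ofReal s *
          cellCountAffinity (sideLength ρ (n + 1)) K (groundState v (n + 1) (sideLength ρ (n + 1))) :=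
        mul_le_mul' le_rfl (hcn hex K hK hKe hKw)
    _ ≤ countAffinity (sideLength ρ (n + 1)) K (groundState v (n + 1) (sideLength ρ (n + 1))) :=
        hsn hex K hK hKw

/-- **NUM^e_h ∧ SUF_h ⟹ LAB^e_h** (the proof of `horizonLabelAffinity_of_count`, parity threaded). [folklore] -/
theorem horizonLabelAffinityEven_of_count (η : ℝ≥0) (hnum : GroundStateHorizonCountAffinityEven η)
    (hsuf : GroundStateHorizonCountSufficiency η) : GroundStateHorizonLabelAffinityEven η := by
  intro v hv ha
  obtain ⟨M₁, hM₁, hnum'⟩ := hnum v hv ha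
  obtain ⟨M₂, hM₂, hsuf'⟩ := hsuf v hv ha
  obtain ⟨c, hc, ρ₁, hρ₁, hc'⟩ := hnum' (max M₁ M₂) (le_max_left _ _)
  obtain ⟨s, hs, ρ₂, hρ₂, hs'⟩ := hsuf' (max M₁ M₂) (le_max_right _ _)
  refine ⟨s * c, mul_pos hs hc, max M₁ M₂, lt_max_of_lt_left hM₁, min ρ₁ ρ₂, lt_min hρ₁ hρ₂,
    fun ρ hρ hρlt => ?_⟩
  have h1 : ρ < ρ₁ := hρlt.trans_le (min_le_left _ _)
  have h2 : ρ < ρ₂ := hρlt.trans_le (min_le_right _ _)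
  filter_upwards [hc' ρ hρ h1, hs' ρ hρ h2] with n hcn hsn hex K hK hKe hKw
  calc ENNReal.ofReal (s * c) = ENNReal.ofReal s * ENNReal.ofReal c := ENNReal.ofReal_mul hs.le
    _ ≤ ENNReal.ofReal s *
          countAffinity (sideLength ρ (n + 1)) K (groundState v (n + 1) (sideLength ρ (n + 1))) :=
        mul_le_mul' le_rfl (hcn hex K hK hKe hKw)
    _ ≤ labelAffinity (sideLength ρ (n + 1)) K (groundState v (n + 1) (sideLength ρ (n + 1))) :=
        hsn hex K hK hKw

/-- **LAB^e_h ⟹ LAB_h** (horizon constant doubled): for any `K` of the window of constant `2M`, the even number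
`2K` lies in the window of constant `M`, and `LAB(2K) ≤ LAB(K)` by refinement monotonicity
(`labelAffinity_mul_le`). [folklore] -/
theorem horizonLabelAffinity_of_even (η : ℝ≥0) (h : GroundStateHorizonLabelAffinityEven η) :
    GroundStateHorizonLabelAffinity η := by
  intro v hv ha
  obtain ⟨c, hc, M, hM, ρ₀, hρ₀, h'⟩ := h v hv ha
  refine ⟨c, hc, 2 * M, by positivity, ρ₀, hρ₀, fun ρ hρ hρlt => ?_⟩
  filter_upwards [h' ρ hρ hρlt] with n hn hex K hK hKw
  have hA : 0 < M * ρ ^ (-(η : ℝ)) := mul_pos hM (Real.rpow_pos_of_pos hρ _)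
  have hKr : (0 : ℝ) < K := by exact_mod_cast hK
  obtain ⟨hw1, hw2⟩ := hKw
  have hKw2 : InWindow (M * ρ ^ (-(η : ℝ))) ρ (sideLength ρ (n + 1)) (K * 2) := by
    constructor
    · rw [Nat.cast_mul, Nat.cast_two, ← div_div, le_div_iff₀ two_pos]
      calc M * ρ ^ (-(η : ℝ)) / Real.sqrt ρ * 2 = 2 * M * ρ ^ (-(η : ℝ)) / Real.sqrt ρ := by ring
        _ ≤ sideLength ρ (n + 1) / K := hw1
    · rw [Nat.cast_mul, Nat.cast_two, ← div_div, div_le_iff₀ two_pos]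
      calc sideLength ρ (n + 1) / K ≤ 2 * (2 * M * ρ ^ (-(η : ℝ))) / Real.sqrt ρ := hw2
        _ = 2 * (M * ρ ^ (-(η : ℝ))) / Real.sqrt ρ * 2 := by ring
  have hL : 0 < sideLength ρ (n + 1) := sideLength_pos_of_inWindow hA hρ (Nat.mul_pos hK two_pos) hKw2
  have hEven : Even (K * 2) := ⟨K, by ring⟩
  exact (hn hex (K * 2) (Nat.mul_pos hK two_pos) hEven hKw2).trans
    (labelAffinity_mul_le hL hK two_pos (measurable_groundState v (n + 1) _))

/-- **LOC_h(η) ∧ CSUF_h(η) ∧ SUF_h(η) ⟹ LAB_h(η)** (0 sorry; DLT_h(η) discharged by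
`CoercivityLine.densityLLNTrunc_holds`): the residual of record of gens 34–36 (LAB_h / NUM_h / MARG_h / INS_h /
DISP_h) is decided by the declared pieces. [folklore] -/
theorem horizonLabelAffinity_of_loc (η : ℝ≥0) (hloc : GroundStateHorizonCondensation η)
    (hcsuf : GroundStateHorizonCellCountSufficiency η) (hsuf : GroundStateHorizonCountSufficiency η) :
    GroundStateHorizonLabelAffinity η :=
  horizonLabelAffinity_of_even η (horizonLabelAffinityEven_of_count η
    (horizonCountAffinityEven_of_cell η
      (horizonCellCountAffinityEven_of_loc η hloc (CoercivityLine.densityLLNTrunc_holds η)) hcsuf) hsuf)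

/-- **MARG_h(η) from the declared pieces**: LOC_h(η) ∧ CSUF_h(η) ∧ SUF_h(η) ⟹ MARG_h(η) (via LAB_h ⟹ NUM_h ⟹ MARG_h).
[folklore] -/
theorem horizonCellCountAffinity_of_loc (η : ℝ≥0) (hloc : GroundStateHorizonCondensation η)
    (hcsuf : GroundStateHorizonCellCountSufficiency η) (hsuf : GroundStateHorizonCountSufficiency η) :
    GroundStateHorizonCellCountAffinity η :=
  horizonCellCountAffinity_of_horizonCountAffinity η
    (horizonCountAffinity_of_horizonLabelAffinity η (horizonLabelAffinity_of_loc η hloc hcsuf hsuf))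

/-- **DECIDING KERNEL OF GEN 36 (v8)** (0 sorry; hypotheses = declared pieces only, NO non-energy residual):
UGS → LOC_h(η) → CSUF_h(η) → SUF_h(η) → `BoseEinsteinCondensation`, for every `η`. [folklore] -/
theorem bec_of_loc (η : ℝ≥0) (hU : BoxGroundStateUniqueness) (hloc : GroundStateHorizonCondensation η)
    (hcsuf : GroundStateHorizonCellCountSufficiency η) (hsuf : GroundStateHorizonCountSufficiency η) :
    _root_.BoseEinsteinCondensation :=
  bec_of_horizonAffinity₀ η hU hloc (horizonLabelAffinity_of_loc η hloc hcsuf hsuf)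

end Summit.AtomisticToContinuum.BoseEinsteinCondensation.Theorems.BoxCountShadow

end
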